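import Summits.QuantumFields.YangMills.Theorems.FluctuationComparisonRegPrIntLLoopLedgerGaussianScaling
import HarnessLib

/-!
# S4-Z1POS: GREP's one-atom normalisations are POSITIVE — `0 < E_C[G]` (hence `Z1_b ≠ 0`) for a continuous, bounded, non-negative atom factor `G` with `G(0) ≠ 0`,
# in GREP's normalised-expectation letter `(∫ φ, G φ·e^{−(φ ⬝ᵥ (C⁻¹ *ᵥ φ))∕2}) ∕ ∫ φ, e^{−(φ ⬝ᵥ (C⁻¹ *ᵥ φ))∕2}`; and `E_C[G] ≤ sup G`

Cell `ym3-torus` (YM ladder rung R3 = continuum `SU(2)` Yang–Mills on the three-torus — a RUNG, NOT d = 4, NOT infinite volume, NOT a mass gap, NOT Clay).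
Width seat `ym3-torus-px20` (gen 16); `--supports stmt-QuantumFields-20520 --as helper`, count-neutral, definition-free, default heartbeats; registry v11.4 №36
untouched.  GREP (✓`AnchorGap.stub_gaussianBBFPolymerRep`) carries the hypothesis `∀ b, Z1 b ≠ 0`, `Z1 b := E (cov ∅ 0) (G b)` = the normalised Gaussian expectation of ONE atom
factor; ✓`…LoopLedgerGasSingletonAbsorption.gas_of_normalised_gas` then absorbs the `Z1_b = 1 + z_b`.  For the atom factors of BLUEPRINT-ECE₁ (`G_b = χ·e^{−V_b}`: smooth cut
✓`…LoopLedgerSmoothCut` × Boltzmann vertex ✓`…LoopLedgerExpVertexTable`, so `0 ≤ G_b ≤ e^{sup|V_b|}`, continuous, `G_b(0) = 1`) this hypothesis is DISCHARGED by the present generic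
file (any positive definite PRECISION matrix `A`, e.g. `A := C⁻¹`):
* §1 `integrable_gaussWeight`, `integrable_mul_gaussWeight` (bounded measurable × the Gaussian weight is integrable — lit ✓`Beta.GaussianIntegral.integrable_exp_neg_half_quadForm`
  BY NAME in the `∕2` spelling); positivity of the normalisation is ✓`LoopLedgerGaussianScaling.integral_exp_neg_quadForm_div_two_pos` (FILE 1, p796991) BY NAME.
* §2 ★★`gaussExpect_pos` (`0 < (∫ G·w) ∕ ∫ w` for `G` continuous, `0 ≤ G ≤ B`, `G x₀ ≠ 0`; Mathlib `integral_pos_of_integrable_nonneg_nonzero` on the open-positive Lebesgue measure),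
  ★`gaussExpect_ne_zero` (GREP's `Z1 b ≠ 0` shape), `gaussExpect_le_of_le` (`E[G] ≤ B`), `gaussExpect_nonneg`.

HONEST SCOPE.  [folklore] positivity of an integral; nothing of GREP's other hypotheses, of the cut∕vertex (whose files supply `G`'s continuity and bounds), of Bałaban's expansions, of
GAS∕GAS₁∕REP∕H4ᶜ∕S2β or of `FluctuationComparisonRegPrIntL` (stmt-QuantumFields-20520) is proved; no summit statement is proved by a helper; rung R3 = SU(2) YM₃ on T³ — NOT d = 4,
NOT infinite volume, NOT a mass gap, NOT Clay; the Yang–Mills mass gap is NOT proved.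

References: D. C. Brydges, Les Houches 1984 [Brydges1986] §3; J. Glimm, A. Jaffe, *Quantum Physics* (1987) §9.1 [GlimmJaffe1987]; T. Bałaban, CMP **102** (1985) [Balaban1985UV3].
-/

set_option autoImplicit false

noncomputable section

open MeasureTheory Matrix

namespace Summit.QuantumFields.YangMills.Theorems.LoopLedgerAtomPositivity

open Literature.MathematicalPhysics.QuantumFieldTheory.Balaban1983to89

variable {ι : Type*} [Fintype ι] [DecidableEq ι]

/-! ## §1 The Gaussian weight -/

/-- the Gaussian weight in the `∕2` spelling is integrable (lit ✓`Beta.GaussianIntegral.integrable_exp_neg_half_quadForm` BY NAME). [folklore] -/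
theorem integrable_gaussWeight {A : Matrix ι ι ℝ} (hA : A.PosDef) :
    Integrable (fun φ : ι → ℝ => Real.exp (-(φ ⬝ᵥ (A *ᵥ φ)) / 2)) := by
  have h : ∀ φ : ι → ℝ, -(φ ⬝ᵥ (A *ᵥ φ)) / 2 = -(1 / 2 : ℝ) * (φ ⬝ᵥ A *ᵥ φ) := fun φ => by ring
  simp_rw [h]
  exact Beta.GaussianIntegral.integrable_exp_neg_half_quadForm A hA

/-- a bounded measurable factor times the Gaussian weight is integrable. [folklore] -/
theorem integrable_mul_gaussWeight {A : Matrix ι ι ℝ} (hA : A.PosDef) {G : (ι → ℝ) → ℝ} (hGm : AEStronglyMeasurable G volume) {B : ℝ}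
    (hGB : ∀ φ, |G φ| ≤ B) :
    Integrable (fun φ : ι → ℝ => G φ * Real.exp (-(φ ⬝ᵥ (A *ᵥ φ)) / 2)) := by
  refine Integrable.bdd_mul (c := B) (integrable_gaussWeight hA) hGm (Filter.Eventually.of_forall fun φ => ?_)
  rw [Real.norm_eq_abs]
  exact hGB φ

/-! ## §2 Positivity and bounds of the normalised expectation -/

/-- `E[G] ≥ 0` for `G ≥ 0`. [folklore] -/
theorem gaussExpect_nonneg {A : Matrix ι ι ℝ} (hA : A.PosDef) {G : (ι → ℝ) → ℝ} (hG0 : ∀ φ, 0 ≤ G φ) :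
    0 ≤ (∫ φ : ι → ℝ, G φ * Real.exp (-(φ ⬝ᵥ (A *ᵥ φ)) / 2)) / ∫ φ : ι → ℝ, Real.exp (-(φ ⬝ᵥ (A *ᵥ φ)) / 2) :=
  div_nonneg (integral_nonneg fun φ => mul_nonneg (hG0 φ) (Real.exp_pos _).le) (LoopLedgerGaussianScaling.integral_exp_neg_quadForm_div_two_pos hA).le

/-- ★★ **positivity**: a continuous factor with `0 ≤ G ≤ B` and `G x₀ ≠ 0` has `0 < E[G]`. [folklore] -/
theorem gaussExpect_pos {A : Matrix ι ι ℝ} (hA : A.PosDef) {G : (ι → ℝ) → ℝ} (hGc : Continuous G) (hG0 : ∀ φ, 0 ≤ G φ) {B : ℝ} (hGB : ∀ φ, G φ ≤ B)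
    {x₀ : ι → ℝ} (hx₀ : G x₀ ≠ 0) :
    0 < (∫ φ : ι → ℝ, G φ * Real.exp (-(φ ⬝ᵥ (A *ᵥ φ)) / 2)) / ∫ φ : ι → ℝ, Real.exp (-(φ ⬝ᵥ (A *ᵥ φ)) / 2) := by
  refine div_pos ?_ (LoopLedgerGaussianScaling.integral_exp_neg_quadForm_div_two_pos hA)
  have hcw : Continuous fun φ : ι → ℝ => Real.exp (-(φ ⬝ᵥ (A *ᵥ φ)) / 2) :=
    Real.continuous_exp.comp (((continuous_id.dotProduct (continuous_const.matrix_mulVec continuous_id)).neg).div_const 2)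
  refine integral_pos_of_integrable_nonneg_nonzero (x := x₀) (hGc.mul hcw)
    (integrable_mul_gaussWeight hA hGc.aestronglyMeasurable (B := B) fun φ => ?_) (fun φ => mul_nonneg (hG0 φ) (Real.exp_pos _).le) ?_
  · rw [abs_of_nonneg (hG0 φ)]
    exact hGB φ
  · exact mul_ne_zero hx₀ (Real.exp_pos _).ne'

/-- ★ GREP's shape: `Z1 ≠ 0`. [folklore] -/
theorem gaussExpect_ne_zero {A : Matrix ι ι ℝ} (hA : A.PosDef) {G : (ι → ℝ) → ℝ} (hGc : Continuous G) (hG0 : ∀ φ, 0 ≤ G φ) {B : ℝ} (hGB : ∀ φ, G φ ≤ B)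
    {x₀ : ι → ℝ} (hx₀ : G x₀ ≠ 0) :
    (∫ φ : ι → ℝ, G φ * Real.exp (-(φ ⬝ᵥ (A *ᵥ φ)) / 2)) / ∫ φ : ι → ℝ, Real.exp (-(φ ⬝ᵥ (A *ᵥ φ)) / 2) ≠ 0 :=
  (gaussExpect_pos hA hGc hG0 hGB hx₀).ne'

/-- `E[G] ≤ B` when `G ≤ B` (and `G` bounded measurable). [folklore] -/
theorem gaussExpect_le_of_le {A : Matrix ι ι ℝ} (hA : A.PosDef) {G : (ι → ℝ) → ℝ} (hGm : AEStronglyMeasurable G volume) {B : ℝ}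
    (hGabs : ∀ φ, |G φ| ≤ B) :
    (∫ φ : ι → ℝ, G φ * Real.exp (-(φ ⬝ᵥ (A *ᵥ φ)) / 2)) / ∫ φ : ι → ℝ, Real.exp (-(φ ⬝ᵥ (A *ᵥ φ)) / 2) ≤ B := by
  rw [div_le_iff₀ (LoopLedgerGaussianScaling.integral_exp_neg_quadForm_div_two_pos hA), ← integral_const_mul]
  refine integral_mono (integrable_mul_gaussWeight hA hGm hGabs) ((integrable_gaussWeight hA).const_mul B) fun φ => ?_
  exact mul_le_mul_of_nonneg_right ((le_abs_self _).trans (hGabs φ)) (Real.exp_pos _).le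

end Summit.QuantumFields.YangMills.Theorems.LoopLedgerAtomPositivity

end
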